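/-
Copyright (c) 2026 the pub-hodgecm-mathlib formalisation cell (harness21).  Prover seat hodgecm-mathlib-F0P3b-p01 (g17): line LH3 (closer stub `stub_N9`), LETTER L1 clause (I₁),
brick (X-core) «CROSS CORNER × A REAL WALL AT A SPLIT PLACE» (LH3-plan (g4) DEAL 2026-09-02T12:00:29Z; road owner LH5-p02 (g4)), layer L2^E «FINSET `E` HELD OUT» in the
PRODUCT-OF-LOCAL-QUOTIENTS form asked by the binder of record (LH5-p02 12:08:17Z) — part 3: (A5a″)^E, the iterated form (held-out local quotients outside).
-/
import Literature.NumberTheory.Rogawski1990.ArchOrbFamGUnfoldedModel       -- ★ (A5a) p851098 (this lineage): §0 `archRG_eq_prod_cpt_mul_prod_split`, `splitCoord_eq_add_half_add_half`; brings ★ (A2)+(A3) p851029, `orbFamG_apply`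
import Literature.NumberTheory.Rogawski1990.ArchChartOrbGHeldOutFinsetPi    -- part 1 (this seat): `chartOrbG_eq_prod_mul_integral_pi_prod_heldOutFinsetPi`, `chartOrbG_eq_prod_mul_integral_integral_heldOutFinsetPi_of_regG`
import HarnessLib

/-!
# (A5a″)^E `orbFamG` WITH A FINSET `E` HELD OUT — LOCAL QUOTIENTS OUTSIDE, SPLIT PLACES UNFOLDED INSIDE (Rogawski 1990 §4.9, §8.2–8.3; Shelstad 1979 §4; Varadarajan 1977 I §1.12)

Topic `NumberTheory/Rogawski1990`; namespace `Literature.NumberTheory.Rogawski1990`.  THEOREMS ONLY (no `def`, no `instance`, no notation, no axiom, no named fact, no `sorry`);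
kernel lane `--kind proof --supports stmt-HodgeConjecture-24833`.  Cell `pub/hodgecm-mathlib`, crux H413 (`stmt-HodgeConjecture-24833`), F0∕P3c line LH3 (closer stub `stub_N9`),
LETTER L1 `HcOrbitalFamiliesStatement`, clause (I₁), organ O-L1e-b «cross corner × a real wall at a split place» ((X-core) road: L1^ι LH5-p02 over ★ L1 LH1-p03, L2^E this seat,
L3^E + head LH5-p02 (g4); dealer LH3-plan (g4) 2026-09-02T12:00:29Z): the raw family `orbFamG` with a FINSET `E` of compact places (those carrying the cross corner's coincidences)
ISOLATED as an outer integral over the PRODUCT of their local quotients `Π_{w ∉ S′, w ∈ E} (U_w ⧸ T′_w)` against `⊗ q_w` (the LHS shape of L1^ι `exists_descent_box_local_param_pi`), the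
other places processed exactly as in ★ (A5a).  Finset twin of ★ (A5a′)∕(A5a″) `ArchOrbFamGUnfoldedModelHeldOut`, on top of part 1 `ArchChartOrbGHeldOutFinsetPi`.

CONVENTIONS as in part 1 (`W`, `U_w`, `T′_w`, `γ_w(c)`, `e`, `q_w = ν′_w ∕ t_w`; `E : Finset W` arbitrary; `ιE = {w : {w // w ∉ S′} // w.1 ∈ E}`, `ιR = {w : {w // w ∉ S′} // w.1 ∉ E}` reading into
L1^ι ∕ ★ (A4′) with `e := fun w => w.1.1`; `M_R, X_R, Q_R`; the point of `Π_w U_w` a plain three-way `dite`, the `E`-slots LOCAL `descConj (γ_w(c)) T′_w _ id (z ⟨⟨w,_⟩,_⟩)`).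
* §4 **`orbFamG_eq_integral_unfoldedModel_heldOutFinsetPi_of_regG`** — (A5a″)^E «held-out local quotients OUTSIDE, split places UNFOLDED INSIDE» for `a′ ∈ C_c(G′_∞)`:
  `orbFamG ν′ a′ S′ c = PREF(c) · ∫_{Π_{ιE}(U⧸T′)} B(c, (z_w γ_w(c) z_w⁻¹)_w) d(⊗_{ιE} q_w)(z)` with the INNER family
  `B(c, u) = ∫ a′ (e⁻¹ (w ↦ [w ∈ S′] φ_w⁻¹(k_w · τ(0,φ_w,θ_w) τ(x_w∕2,0,0) n_w τ(x_w∕2,0,0) · k_w⁻¹) ∣ [w ∈ E] u_w ∣ [else] (g γ_R(c) g⁻¹)_w)) d((⊗ κ⊗μ_N) ⊗ Q_R)` written out at `u_w := z_w γ_w(c) z_w⁻¹`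
  (LOCAL `descConj (γ_w(c)) T′_w _ id (z ⟨⟨w,_⟩,_⟩)`) — i.e. the LHS of L1^ι `exists_descent_box_local_param_pi` with `ι := ιE`, `e := fun w => w.1.1`, `B c u := ∫ …`; `PREF(c)` = ★ (A5a)'s
  explicit triple product.  Fubini at the part-1 stage; ★ (A2)+(A3) INSIDE the outer integral with spectator `X_R`.  (§3, the product form, is the sibling file
  `ArchOrbFamGUnfoldedModelHeldOutFinsetPi`.)
* §4′ `prod_splitNormaliser_mul_integral_heldOutFinsetPi_eq` — the POINTWISE kernel of §4 at a frozen held-out point `z` (★ (A2)+(A3) inside, spectator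
  `X_R`), exported as its own declaration (2026-09-02, buildfix census B42-N14) so that both declarations elaborate well inside the DEFAULT heartbeat budget.
HONEST LABEL: HC_CM is proved only modulo the 7 printed citations (2 remaining named inputs: hLiu418 = `stmt-HodgeConjecture-24832`, h413 = `stmt-HodgeConjecture-24833`) until rung 0
closes; count-neutral letter-L1 plumbing.

## References
* [Rogawski1990] J. D. Rogawski, *Automorphic Representations of Unitary Groups in Three Variables*, Ann. of Math. Stud. 123 (1990), §4.9 (4.9.1)–(4.9.2) p. 55, §8.2 p. 122, §8.3 p. 124.
* [Shelstad1979] D. Shelstad, *Characters and inner forms of a quasi-split group over ℝ*, Compositio Math. 39 (1979), §4 pp. 22–24.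
* [Gelbart1975] S. Gelbart, *Automorphic Forms on Adele Groups*, Ann. of Math. Studies 83 (1975), §10 p. 155 (10.19); [Varadarajan1977] V. S. Varadarajan, *Harmonic Analysis on Real Reductive Groups*, LNM 576 (1977), Part I §1.12.
* [DeitmarEchterhoff2014] A. Deitmar, S. Echterhoff, *Principles of Harmonic Analysis*, 2nd ed. (2014), Thm. 1.5.3, Lemma 9.3.3; [Folland1995] G. B. Folland, *A Course in Abstract Harmonic Analysis* (1995), §2.6 (2.52).
-/

set_option autoImplicit false
noncomputable section
open MeasureTheory MeasureTheory.Measure Set NumberField NumberField.InfinitePlace Complex Topology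
open Literature.MeasureTheory.Group Literature.NumberTheory.Rogawski1990 Literature.NumberTheory.Automorphic Literature.NumberTheory.Automorphic.UnitaryGroup
open Literature.NumberTheory.Automorphic.ArchCartan
open scoped ContDiff Classical ENNReal NNReal MatrixGroups

namespace Literature.NumberTheory.Rogawski1990

/-! ## §4 (A5a″)^E, PRODUCT FORM: the held-out local quotients OUTSIDE, the split places unfolded INSIDE -/
section AssemblyFinsetPiIterated
variable (L : Type) [Field L] [NumberField L] [IsCMField L] (α : Fin 3 → L) (S' : Finset {w : InfinitePlace L // IsComplex w})
  [∀ w : {w : InfinitePlace L // IsComplex w}, MeasurableSpace ↥(archLocal L 3 (Matrix.diagonal α) w)]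
  [∀ w : {w : InfinitePlace L // IsComplex w}, BorelSpace ↥(archLocal L 3 (Matrix.diagonal α) w)]
  [∀ w : {w : InfinitePlace L // IsComplex w}, LocallyCompactSpace ↥(archLocal L 3 (Matrix.diagonal α) w)]
  [∀ w : {w : InfinitePlace L // IsComplex w}, SecondCountableTopology ↥(archLocal L 3 (Matrix.diagonal α) w)]
  [MeasurableSpace ↥(arch (↥(maximalRealSubfield L)) L (IsCMField.complexConj L) 3 (Matrix.diagonal α))]
  [BorelSpace ↥(arch (↥(maximalRealSubfield L)) L (IsCMField.complexConj L) 3 (Matrix.diagonal α))]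
  [∀ w : {w : InfinitePlace L // IsComplex w}, MeasurableSpace (↥(archLocal L 3 (Matrix.diagonal α) w) ⧸ chartTorusGLoc L α w S')]
  [∀ w : {w : InfinitePlace L // IsComplex w}, BorelSpace (↥(archLocal L 3 (Matrix.diagonal α) w) ⧸ chartTorusGLoc L α w S')]
  (ν'w : ∀ w : {w : InfinitePlace L // IsComplex w}, Measure ↥(archLocal L 3 (Matrix.diagonal α) w)) [∀ w, (ν'w w).IsHaarMeasure] [∀ w, (ν'w w).IsMulRightInvariant]
  (ν' : Measure ↥(arch (↥(maximalRealSubfield L)) L (IsCMField.complexConj L) 3 (Matrix.diagonal α))) [ν'.IsHaarMeasure] [ν'.IsMulRightInvariant]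
  (hν : ν' = (Measure.pi ν'w).map (archPiEquivCM 3 L (Matrix.diagonal α)).symm)
  (t : ∀ w : {w : InfinitePlace L // IsComplex w}, Measure ↥(chartTorusGLoc L α w S')) [∀ w, (t w).IsHaarMeasure] [∀ w, (t w).IsInvInvariant]
  -- the held-out finset `E`: `E`-factor the PRODUCT of the local quotients `Π_{w ∉ S′, w ∈ E} (U_w ⧸ T′_w)`, rest factor ONE quotient `(Π_{w ∉ S′, w ∉ E} U_w) ⧸ Π T′_w`
  (E : Finset {w : InfinitePlace L // IsComplex w})
  [MeasurableSpace ((∀ w : {w : {w : {w : InfinitePlace L // IsComplex w} // w ∉ S'} // w.1 ∉ E}, ↥(archLocal L 3 (Matrix.diagonal α) w.1.1)) ⧸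
            Subgroup.pi Set.univ (fun w : {w : {w : {w : InfinitePlace L // IsComplex w} // w ∉ S'} // w.1 ∉ E} => chartTorusGLoc L α w.1.1 S'))]
  [BorelSpace ((∀ w : {w : {w : {w : InfinitePlace L // IsComplex w} // w ∉ S'} // w.1 ∉ E}, ↥(archLocal L 3 (Matrix.diagonal α) w.1.1)) ⧸
            Subgroup.pi Set.univ (fun w : {w : {w : {w : InfinitePlace L // IsComplex w} // w ∉ S'} // w.1 ∉ E} => chartTorusGLoc L α w.1.1 S'))]
  (ρR : Measure ↥(Subgroup.pi Set.univ (fun w : {w : {w : {w : InfinitePlace L // IsComplex w} // w ∉ S'} // w.1 ∉ E} => chartTorusGLoc L α w.1.1 S')))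
  [ρR.IsHaarMeasure] [ρR.IsInvInvariant]
  (hρR : Measure.map (subgroupPiCoords fun w : {w : {w : {w : InfinitePlace L // IsComplex w} // w ∉ S'} // w.1 ∉ E} => chartTorusGLoc L α w.1.1 S') ρR =
    Measure.pi fun w : {w : {w : {w : InfinitePlace L // IsComplex w} // w ∉ S'} // w.1 ∉ E} => t w.1.1)
  -- the standard split group `U(J₃)(ℂ)` and the per-place transports (★ (A2)), as in ★ (A5a)
  {J : Matrix (Fin 3) (Fin 3) ℂ} (hJ : J = (StdForm.antidiagonal 3).over ℂ)
  [MeasurableSpace ↥(unitaryGroupOfForm (starRingEnd ℂ) J)] [BorelSpace ↥(unitaryGroupOfForm (starRingEnd ℂ) J)]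
  [MeasurableSpace (↥(unitaryGroupOfForm (starRingEnd ℂ) J) ⧸ torusU (starRingEnd ℂ) J)] [BorelSpace (↥(unitaryGroupOfForm (starRingEnd ℂ) J) ⧸ torusU (starRingEnd ℂ) J)]
  (φ : ∀ w : {w : {w : InfinitePlace L // IsComplex w} // w ∈ S'}, ↥(archLocal L 3 (Matrix.diagonal α) w.1) ≃ₜ* ↥(unitaryGroupOfForm (starRingEnd ℂ) J))
  (hφT : ∀ (w : {w : {w : InfinitePlace L // IsComplex w} // w ∈ S'}) (g : ↥(archLocal L 3 (Matrix.diagonal α) w.1)),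
    (φ w).toMulEquiv g ∈ torusU (starRingEnd ℂ) J ↔ g ∈ chartTorusGLoc L α w.1 S')
  (hφd : ∀ (w : {w : {w : InfinitePlace L // IsComplex w} // w ∈ S'}) (cw : Fin 3 → ℝ),
    glDiagonal 3 ℂ (fun i => Units.mk0 (boostEig cw i) (boostEig_ne_zero cw i)) = ((φ w (gprimeBlockAt L α w.1 S' cw) : ↥(unitaryGroupOfForm (starRingEnd ℂ) J)) : GL (Fin 3) ℂ))
  {K : Subgroup ↥(unitaryGroupOfForm (starRingEnd ℂ) J)} (κ : Measure ↥K) [SigmaFinite κ]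
  (μN : Measure ↥(unipotentU (starRingEnd ℂ) J)) [IsHaarMeasure μN]
  {C : {w : {w : InfinitePlace L // IsComplex w} // w ∈ S'} → ℝ≥0}
  (hμC : ∀ w : {w : {w : InfinitePlace L // IsComplex w} // w ∈ S'},
    (quotientMeasure (chartTorusGLoc L α w.1 S') (t w.1) (isClosed_chartTorusGLoc L α w.1 S') (ν'w w.1)).map
        (cosetCongr (φ w).toMulEquiv (chartTorusGLoc L α w.1 S') (torusU (starRingEnd ℂ) J) (hφT w)) =
      C w • Measure.map
        (fun p : ↥K × ↥(unipotentU (starRingEnd ℂ) J) =>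
          (QuotientGroup.mk ((p.1 : ↥(unitaryGroupOfForm (starRingEnd ℂ) J)) * (p.2 : ↥(unitaryGroupOfForm (starRingEnd ℂ) J))) :
            ↥(unitaryGroupOfForm (starRingEnd ℂ) J) ⧸ torusU (starRingEnd ℂ) J))
        (κ.prod μN))
  -- the boost torus family on `U(J₃)(ℂ)` (★ `exists_torusU_boostEig_family`)
  (τ : (Fin 3 → ℝ) → ↥(unitaryGroupOfForm (starRingEnd ℂ) J)) (hτT : ∀ c, τ c ∈ torusU (starRingEnd ℂ) J)
  (hτcoe : ∀ c, (((τ c : ↥(unitaryGroupOfForm (starRingEnd ℂ) J)) : GL (Fin 3) ℂ) : Matrix (Fin 3) (Fin 3) ℂ) = Matrix.diagonal (boostEig c))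
  (hτmul : ∀ c c', τ (c + c') = τ c * τ c')
  (hτd : ∀ c, ∃ d : Fin 3 → ℂˣ, glDiagonal 3 ℂ d = ((τ c : ↥(unitaryGroupOfForm (starRingEnd ℂ) J)) : GL (Fin 3) ℂ) ∧ ∀ i, (d i : ℂ) = boostEig c i)

omit [MeasurableSpace ↥(arch (↥(maximalRealSubfield L)) L (IsCMField.complexConj L) 3 (Matrix.diagonal α))]
  [BorelSpace ↥(arch (↥(maximalRealSubfield L)) L (IsCMField.complexConj L) 3 (Matrix.diagonal α))] in
include hJ hφT hφd hμC hτT hτcoe hτmul hτd in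
/-- **(A5a″)^E — THE INNER UNFOLDING AT A FROZEN HELD-OUT POINT `z`** (the pointwise kernel of
`orbFamG_eq_integral_unfoldedModel_heldOutFinsetPi_of_regG`, exported as its own declaration so that each of the two elaborates well inside the DEFAULT
heartbeat budget — buildfix census B42-N14, 2026-09-02).  For `a′ ∈ C(G′_∞)`, a label `c` with `c_w(0) ≠ 0` at the split places (`c ∈ RegG S′`) and ANY point
`z ∈ Π_{w ∉ S′, w ∈ E} (U_w ⧸ T′_w)`: ★ (A2)+(A3) `prod_normaliser_smul_integral_pi_descConj_eq_smul_integral_pi_prod_symm` applied INSIDE, with spectator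
`X_R = (Π_{w ∉ S′, w ∉ E} U_w) ⧸ Π T′_w` and the continuous integrand `(u, gM_R) ↦ a′(e⁻¹(w ↦ [w ∈ S′] u_w ∣ [w ∈ E] z_w γ_w(c) z_w⁻¹ ∣ [else] (g γ_R(c) g⁻¹)_w))`:
`(∏_{w∈S′} Δ_w(c)) · ∫ a′(…(u_w γ_w(c) u_w⁻¹)_{w∈S′}…) d((⊗_{S′} q_w) ⊗ Q_R) = (∏_{w∈S′} C_w) · ∫ a′(…(φ_w⁻¹(k_w τ(0,φ_w,θ_w) τ(x_w∕2,0,0) n_w τ(x_w∕2,0,0) k_w⁻¹))_{w∈S′}…) d((⊗_{S′} κ⊗μ_N) ⊗ Q_R)`,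
`Δ_w(c) = |eˣ − e⁻ˣ|·|e^{x+iθ} − e^{iφ}|·|e^{−x+iθ} − e^{iφ}|` the split normaliser of ★ `archRG_eq_prod_cpt_mul_prod_split`.
[cite: Varadarajan1977, I §1.12] [cite: Rogawski1990, §4.9 (4.9.1)–(4.9.2) p. 55; §8.2 p. 122] [cite: Shelstad1979, §4 pp. 22–24] [cite: DeitmarEchterhoff2014, Thm. 1.5.3] -/
theorem prod_splitNormaliser_mul_integral_heldOutFinsetPi_eq
    {a' : ↥(arch (↥(maximalRealSubfield L)) L (IsCMField.complexConj L) 3 (Matrix.diagonal α)) → ℂ} (ha'c : Continuous a')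
    {c : {w : InfinitePlace L // IsComplex w} → Fin 3 → ℝ} (hc : c ∈ RegG S')
    -- Radon∕σ-finiteness data of the local quotients `q_w` (`w ∈ S′`) and of the spectator `(X_R, Q_R)` (instances at every call site; binders here)
    [∀ w : {w : {w : InfinitePlace L // IsComplex w} // w ∈ S'},
      SigmaFinite (quotientMeasure (chartTorusGLoc L α w.1 S') (t w.1) (isClosed_chartTorusGLoc L α w.1 S') (ν'w w.1))]
    [∀ w : {w : {w : InfinitePlace L // IsComplex w} // w ∈ S'},
      IsFiniteMeasureOnCompacts (quotientMeasure (chartTorusGLoc L α w.1 S') (t w.1) (isClosed_chartTorusGLoc L α w.1 S') (ν'w w.1))]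
    [SecondCountableTopology ((∀ w : {w : {w : {w : InfinitePlace L // IsComplex w} // w ∉ S'} // w.1 ∉ E}, ↥(archLocal L 3 (Matrix.diagonal α) w.1.1)) ⧸
      Subgroup.pi Set.univ (fun w : {w : {w : {w : InfinitePlace L // IsComplex w} // w ∉ S'} // w.1 ∉ E} => chartTorusGLoc L α w.1.1 S'))]
    [SFinite (quotientMeasure (Subgroup.pi Set.univ (fun w : {w : {w : {w : InfinitePlace L // IsComplex w} // w ∉ S'} // w.1 ∉ E} => chartTorusGLoc L α w.1.1 S')) ρR
      (isClosed_coe_pi _ fun w => isClosed_chartTorusGLoc L α w.1.1 S')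
      (Measure.pi fun w : {w : {w : {w : InfinitePlace L // IsComplex w} // w ∉ S'} // w.1 ∉ E} => ν'w w.1.1))]
    (z : (∀ w : {w : {w : {w : InfinitePlace L // IsComplex w} // w ∉ S'} // w.1 ∈ E}, ↥(archLocal L 3 (Matrix.diagonal α) w.1.1) ⧸ chartTorusGLoc L α w.1.1 S')) :
    (∏ w : ↥S', ((|Real.exp (c w 0) - Real.exp (-c w 0)| *
        ‖Complex.exp (c w 0 + c w 2 * I) - Complex.exp (c w 1 * I)‖ * ‖Complex.exp (-c w 0 + c w 2 * I) - Complex.exp (c w 1 * I)‖ : ℝ) : ℂ)) *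
        ∫ p : (∀ w : {w : {w : InfinitePlace L // IsComplex w} // w ∈ S'}, ↥(archLocal L 3 (Matrix.diagonal α) w.1) ⧸ chartTorusGLoc L α w.1 S') ×
            ((∀ w : {w : {w : {w : InfinitePlace L // IsComplex w} // w ∉ S'} // w.1 ∉ E}, ↥(archLocal L 3 (Matrix.diagonal α) w.1.1)) ⧸
          Subgroup.pi Set.univ (fun w : {w : {w : {w : InfinitePlace L // IsComplex w} // w ∉ S'} // w.1 ∉ E} => chartTorusGLoc L α w.1.1 S')),
          a' ((archPiEquivCM 3 L (Matrix.diagonal α)).symm (fun w =>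
          if h : w ∈ S' then
            descConj (gprimeBlockAt L α w S' (c w)) (chartTorusGLoc L α w S') (forall_mem_chartTorusGLoc_comm L α w S' (c w)) id (p.1 ⟨w, h⟩)
          else if hE : w ∈ E then
            descConj (gprimeBlockAt L α w S' (c w)) (chartTorusGLoc L α w S') (forall_mem_chartTorusGLoc_comm L α w S' (c w)) id (z ⟨⟨w, h⟩, hE⟩)
          else
            descConj (fun w : {w : {w : {w : InfinitePlace L // IsComplex w} // w ∉ S'} // w.1 ∉ E} => gprimeBlock L α w.1.1 S' c)
              (Subgroup.pi Set.univ (fun w : {w : {w : {w : InfinitePlace L // IsComplex w} // w ∉ S'} // w.1 ∉ E} => chartTorusGLoc L α w.1.1 S'))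
              (forall_mem_pi_chartTorusGLoc_comm L α S' (fun w : {w : {w : {w : InfinitePlace L // IsComplex w} // w ∉ S'} // w.1 ∉ E} => w.1.1) c)
              (fun g => (g ⟨⟨w, h⟩, hE⟩ : ↥(archLocal L 3 (Matrix.diagonal α) w))) p.2))
          ∂((Measure.pi fun w : {w : {w : InfinitePlace L // IsComplex w} // w ∈ S'} =>
              quotientMeasure (chartTorusGLoc L α w.1 S') (t w.1) (isClosed_chartTorusGLoc L α w.1 S') (ν'w w.1)).prod
            (quotientMeasure (Subgroup.pi Set.univ (fun w : {w : {w : {w : InfinitePlace L // IsComplex w} // w ∉ S'} // w.1 ∉ E} => chartTorusGLoc L α w.1.1 S')) ρR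
          (isClosed_coe_pi _ fun w => isClosed_chartTorusGLoc L α w.1.1 S')
          (Measure.pi fun w : {w : {w : {w : InfinitePlace L // IsComplex w} // w ∉ S'} // w.1 ∉ E} => ν'w w.1.1))) =
      ((∏ w : {w : {w : InfinitePlace L // IsComplex w} // w ∈ S'}, (C w : ℝ) : ℝ) : ℂ) *
        ∫ q : ({w : {w : InfinitePlace L // IsComplex w} // w ∈ S'} → ↥K × ↥(unipotentU (starRingEnd ℂ) J)) ×
            ((∀ w : {w : {w : {w : InfinitePlace L // IsComplex w} // w ∉ S'} // w.1 ∉ E}, ↥(archLocal L 3 (Matrix.diagonal α) w.1.1)) ⧸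
          Subgroup.pi Set.univ (fun w : {w : {w : {w : InfinitePlace L // IsComplex w} // w ∉ S'} // w.1 ∉ E} => chartTorusGLoc L α w.1.1 S')),
          a' ((archPiEquivCM 3 L (Matrix.diagonal α)).symm (fun w =>
          if h : w ∈ S' then
            (φ ⟨w, h⟩).symm (((q.1 ⟨w, h⟩).1 : ↥(unitaryGroupOfForm (starRingEnd ℂ) J)) *
              (τ ![0, c w 1, c w 2] * τ ![c w 0 / 2, 0, 0] * ((q.1 ⟨w, h⟩).2 : ↥(unitaryGroupOfForm (starRingEnd ℂ) J)) * τ ![c w 0 / 2, 0, 0]) *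
              ((q.1 ⟨w, h⟩).1 : ↥(unitaryGroupOfForm (starRingEnd ℂ) J))⁻¹)
          else if hE : w ∈ E then
            descConj (gprimeBlockAt L α w S' (c w)) (chartTorusGLoc L α w S') (forall_mem_chartTorusGLoc_comm L α w S' (c w)) id (z ⟨⟨w, h⟩, hE⟩)
          else
            descConj (fun w : {w : {w : {w : InfinitePlace L // IsComplex w} // w ∉ S'} // w.1 ∉ E} => gprimeBlock L α w.1.1 S' c)
              (Subgroup.pi Set.univ (fun w : {w : {w : {w : InfinitePlace L // IsComplex w} // w ∉ S'} // w.1 ∉ E} => chartTorusGLoc L α w.1.1 S'))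
              (forall_mem_pi_chartTorusGLoc_comm L α S' (fun w : {w : {w : {w : InfinitePlace L // IsComplex w} // w ∉ S'} // w.1 ∉ E} => w.1.1) c)
              (fun g => (g ⟨⟨w, h⟩, hE⟩ : ↥(archLocal L 3 (Matrix.diagonal α) w))) q.2))
          ∂((Measure.pi fun _ : {w : {w : InfinitePlace L // IsComplex w} // w ∈ S'} => κ.prod μN).prod
            (quotientMeasure (Subgroup.pi Set.univ (fun w : {w : {w : {w : InfinitePlace L // IsComplex w} // w ∉ S'} // w.1 ∉ E} => chartTorusGLoc L α w.1.1 S')) ρR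
          (isClosed_coe_pi _ fun w => isClosed_chartTorusGLoc L α w.1.1 S')
          (Measure.pi fun w : {w : {w : {w : InfinitePlace L // IsComplex w} // w ∉ S'} // w.1 ∉ E} => ν'w w.1.1))) := by
  choose d hd hdc using hτd
  have hγt : ∀ w : {w : {w : InfinitePlace L // IsComplex w} // w ∈ S'}, (φ w) (gprimeBlockAt L α w.1 S' (c w.1)) = τ (c w.1) := fun w => by
    apply Subtype.ext
    apply Units.ext
    rw [← hφd w (c w.1), coe_glDiagonal, hτcoe]
    rfl
  have htms : ∀ w : {w : {w : InfinitePlace L // IsComplex w} // w ∈ S'},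
      τ (c w.1) = τ ![0, c w.1 1, c w.1 2] * τ ![c w.1 0 / 2, 0, 0] * τ ![c w.1 0 / 2, 0, 0] := fun w => by
    conv_lhs => rw [splitCoord_eq_add_half_add_half (c w.1)]
    rw [hτmul, hτmul]
  have hFc : Continuous fun p : (∀ w : {w : {w : InfinitePlace L // IsComplex w} // w ∈ S'}, ↥(archLocal L 3 (Matrix.diagonal α) w.1)) ×
      ((∀ w : {w : {w : {w : InfinitePlace L // IsComplex w} // w ∉ S'} // w.1 ∉ E}, ↥(archLocal L 3 (Matrix.diagonal α) w.1.1)) ⧸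
          Subgroup.pi Set.univ (fun w : {w : {w : {w : InfinitePlace L // IsComplex w} // w ∉ S'} // w.1 ∉ E} => chartTorusGLoc L α w.1.1 S')) =>
      a' ((archPiEquivCM 3 L (Matrix.diagonal α)).symm (fun w =>
          if h : w ∈ S' then
            p.1 ⟨w, h⟩
          else if hE : w ∈ E then
            descConj (gprimeBlockAt L α w S' (c w)) (chartTorusGLoc L α w S') (forall_mem_chartTorusGLoc_comm L α w S' (c w)) id (z ⟨⟨w, h⟩, hE⟩)
          else
            descConj (fun w : {w : {w : {w : InfinitePlace L // IsComplex w} // w ∉ S'} // w.1 ∉ E} => gprimeBlock L α w.1.1 S' c)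
              (Subgroup.pi Set.univ (fun w : {w : {w : {w : InfinitePlace L // IsComplex w} // w ∉ S'} // w.1 ∉ E} => chartTorusGLoc L α w.1.1 S'))
              (forall_mem_pi_chartTorusGLoc_comm L α S' (fun w : {w : {w : {w : InfinitePlace L // IsComplex w} // w ∉ S'} // w.1 ∉ E} => w.1.1) c)
              (fun g => (g ⟨⟨w, h⟩, hE⟩ : ↥(archLocal L 3 (Matrix.diagonal α) w))) p.2)) := by
    refine ha'c.comp ((archPiEquivCM 3 L (Matrix.diagonal α)).symm.continuous.comp (continuous_pi fun w => ?_))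
    by_cases h : w ∈ S'
    · simp only [dif_pos h]
      exact (continuous_apply _).comp continuous_fst
    · by_cases hE : w ∈ E
      · simp only [dif_neg h, dif_pos hE]
        exact continuous_const
      · simp only [dif_neg h, dif_neg hE]
        exact (continuous_descConj _ _ _ (continuous_apply _)).comp continuous_snd
  have hB := prod_normaliser_smul_integral_pi_descConj_eq_smul_integral_pi_prod_symm hJ
    (fun w : {w : {w : InfinitePlace L // IsComplex w} // w ∈ S'} => chartTorusGLoc L α w.1 S')
    (fun w => quotientMeasure (chartTorusGLoc L α w.1 S') (t w.1) (isClosed_chartTorusGLoc L α w.1 S') (ν'w w.1)) φ hφT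
    (fun _ => K) (fun _ => κ) (fun _ => μN) hμC (fun w => forall_mem_chartTorusGLoc_comm L α w.1 S' (c w.1)) hγt
    (fun w => hτT _) (fun w => hτT _) htms (fun w => c w.1) (fun w => hc.2 w.1 w.2)
    (fun w => hd _) (fun w j => hdc _ j) (fun w => hd _) (fun w j => hdc _ j)
    (quotientMeasure (Subgroup.pi Set.univ (fun w : {w : {w : {w : InfinitePlace L // IsComplex w} // w ∉ S'} // w.1 ∉ E} => chartTorusGLoc L α w.1.1 S')) ρR
          (isClosed_coe_pi _ fun w => isClosed_chartTorusGLoc L α w.1.1 S')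
          (Measure.pi fun w : {w : {w : {w : InfinitePlace L // IsComplex w} // w ∉ S'} // w.1 ∉ E} => ν'w w.1.1)) _ hFc
  exact (congrArg₂ (· * ·) (Complex.ofReal_prod _ _).symm rfl).trans ((Complex.real_smul.symm.trans hB).trans Complex.real_smul)

include hν hρR hJ hφT hφd hμC hτT hτcoe hτmul hτd in
/-- **(A5a″)^E HELD-OUT LOCAL QUOTIENTS OUTSIDE, UNFOLDED INSIDE — the LHS shape of L1^ι.**  Same data as (A5a′)^E; for `a′ ∈ C_c(G′_∞)` and every `G`-REGULAR `c`:
**`orbFamG ν′ a′ S′ c = PREF(c) · ∫_{Π_{ιE} (U_w⧸T′_w)} B(c, (z_w γ_w(c) z_w⁻¹)_{w}) d(⊗_{ιE} q_w)(z)`**, where the integrand is the INNER family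
`B(c, u) = ∫ a′ (e⁻¹ (w ↦ [w ∈ S′] φ_w⁻¹(k_w · τ(0,φ_w,θ_w) τ(x_w∕2,0,0) n_w τ(x_w∕2,0,0) · k_w⁻¹) ∣ [w ∈ E] u_w ∣ [else] (g γ_R(c) g⁻¹)_w)) d((⊗_{w∈S′} (κ ⊗ μ_N)) ⊗ Q_R)(y, gM_R)` WRITTEN OUT at
`u_w := z_w γ_w(c) z_w⁻¹` (`descConj (gprimeBlockAt L α w S′ (c w)) (chartTorusGLoc L α w S′) _ id (z ⟨⟨w,_⟩,_⟩)`) and `PREF(c) = (∏_{w∉S′} signed_w) · (∏_w t_w(B′_w)) · (∏_{w∈S′} C_w)` —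
L1^ι `exists_descent_box_local_param_pi`'s left-hand side with `ι := ιE`, `e := fun w => w.1.1`, `ν₀ := ν′w`, `t₀ := t`, `B c u := ∫ …` (its `B y (fun i => descConj … id (z i))` β∕proj-reduces to
this integrand).  Fubini at the part-1 stage (★ `integral_prod_prodLeftComm`, integrability ★ (A1) transported); ★ (A2)+(A3) INSIDE the outer integral with spectator `X_R`.
[cite: Varadarajan1977, I §1.12] [cite: Rogawski1990, §4.9 (4.9.1)–(4.9.2) p. 55; §8.2 p. 122; §8.3 p. 124] [cite: Shelstad1979, §4 pp. 22–24] [cite: DeitmarEchterhoff2014, Lemma 9.3.3] -/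
theorem orbFamG_eq_integral_unfoldedModel_heldOutFinsetPi_of_regG (hα : ∀ i, α i ≠ 0) (hS' : ∀ w, w ∈ S' → w ∈ splitChartPlaces L α)
    {a' : ↥(arch (↥(maximalRealSubfield L)) L (IsCMField.complexConj L) 3 (Matrix.diagonal α)) → ℂ} (ha'c : Continuous a') (ha's : HasCompactSupport a')
    {c : {w : InfinitePlace L // IsComplex w} → Fin 3 → ℝ} (hc : c ∈ RegG S') :
    orbFamG L α ν' a' S' c =
      (∏ w ∈ Finset.univ.filter (fun w => w ∉ S'),
          ((1 - (Circle.exp (c w 1 - c w 0) : ℂ)) * (1 - (Circle.exp (c w 2 - c w 0) : ℂ)) * (1 - (Circle.exp (c w 2 - c w 1) : ℂ)))) *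
        (∏ w, ((t w (chartBoxImgGLoc L α w S')).toReal : ℂ)) * ((∏ w : {w : {w : InfinitePlace L // IsComplex w} // w ∈ S'}, (C w : ℝ) : ℝ) : ℂ) *
        ∫ z : (∀ w : {w : {w : {w : InfinitePlace L // IsComplex w} // w ∉ S'} // w.1 ∈ E}, ↥(archLocal L 3 (Matrix.diagonal α) w.1.1) ⧸ chartTorusGLoc L α w.1.1 S'),
          (∫ q : ({w : {w : InfinitePlace L // IsComplex w} // w ∈ S'} → ↥K × ↥(unipotentU (starRingEnd ℂ) J)) ×
              ((∀ w : {w : {w : {w : InfinitePlace L // IsComplex w} // w ∉ S'} // w.1 ∉ E}, ↥(archLocal L 3 (Matrix.diagonal α) w.1.1)) ⧸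
            Subgroup.pi Set.univ (fun w : {w : {w : {w : InfinitePlace L // IsComplex w} // w ∉ S'} // w.1 ∉ E} => chartTorusGLoc L α w.1.1 S')),
            a' ((archPiEquivCM 3 L (Matrix.diagonal α)).symm (fun w =>
            if h : w ∈ S' then
              (φ ⟨w, h⟩).symm (((q.1 ⟨w, h⟩).1 : ↥(unitaryGroupOfForm (starRingEnd ℂ) J)) *
                (τ ![0, c w 1, c w 2] * τ ![c w 0 / 2, 0, 0] * ((q.1 ⟨w, h⟩).2 : ↥(unitaryGroupOfForm (starRingEnd ℂ) J)) * τ ![c w 0 / 2, 0, 0]) *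
                ((q.1 ⟨w, h⟩).1 : ↥(unitaryGroupOfForm (starRingEnd ℂ) J))⁻¹)
            else if hE : w ∈ E then
              descConj (gprimeBlockAt L α w S' (c w)) (chartTorusGLoc L α w S') (forall_mem_chartTorusGLoc_comm L α w S' (c w)) id (z ⟨⟨w, h⟩, hE⟩)
            else
              descConj (fun w : {w : {w : {w : InfinitePlace L // IsComplex w} // w ∉ S'} // w.1 ∉ E} => gprimeBlock L α w.1.1 S' c)
                (Subgroup.pi Set.univ (fun w : {w : {w : {w : InfinitePlace L // IsComplex w} // w ∉ S'} // w.1 ∉ E} => chartTorusGLoc L α w.1.1 S'))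
                (forall_mem_pi_chartTorusGLoc_comm L α S' (fun w : {w : {w : {w : InfinitePlace L // IsComplex w} // w ∉ S'} // w.1 ∉ E} => w.1.1) c)
                (fun g => (g ⟨⟨w, h⟩, hE⟩ : ↥(archLocal L 3 (Matrix.diagonal α) w))) q.2))
            ∂((Measure.pi fun _ : {w : {w : InfinitePlace L // IsComplex w} // w ∈ S'} => κ.prod μN).prod
              (quotientMeasure (Subgroup.pi Set.univ (fun w : {w : {w : {w : InfinitePlace L // IsComplex w} // w ∉ S'} // w.1 ∉ E} => chartTorusGLoc L α w.1.1 S')) ρR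
            (isClosed_coe_pi _ fun w => isClosed_chartTorusGLoc L α w.1.1 S')
            (Measure.pi fun w : {w : {w : {w : InfinitePlace L // IsComplex w} // w ∉ S'} // w.1 ∉ E} => ν'w w.1.1))))
          ∂(Measure.pi fun w : {w : {w : {w : InfinitePlace L // IsComplex w} // w ∉ S'} // w.1 ∈ E} =>
            quotientMeasure (chartTorusGLoc L α w.1.1 S') (t w.1.1) (isClosed_chartTorusGLoc L α w.1.1 S') (ν'w w.1.1)) := by
  refine (orbFamG_apply L α ν' a' hS' c).trans ?_
  refine (congrArg₂ (· * ·) (archRG_eq_prod_cpt_mul_prod_split S' c)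
    (chartOrbG_eq_prod_mul_integral_integral_heldOutFinsetPi_of_regG L α S' ν'w ν' hν t E ρR hρR hα hS' hc ha'c ha's)).trans ?_
  haveI : ∀ w : {w : InfinitePlace L // IsComplex w}, SecondCountableTopology (↥(archLocal L 3 (Matrix.diagonal α) w) ⧸ chartTorusGLoc L α w S') := fun w => inferInstance
  haveI : ∀ w : {w : InfinitePlace L // IsComplex w},
      SigmaFinite (quotientMeasure (chartTorusGLoc L α w S') (t w) (isClosed_chartTorusGLoc L α w S') (ν'w w)) := fun w => inferInstance
  have hMcR : IsClosed ((Subgroup.pi Set.univ (fun w : {w : {w : {w : InfinitePlace L // IsComplex w} // w ∉ S'} // w.1 ∉ E} => chartTorusGLoc L α w.1.1 S')) :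
      Set (∀ w : {w : {w : {w : InfinitePlace L // IsComplex w} // w ∉ S'} // w.1 ∉ E}, ↥(archLocal L 3 (Matrix.diagonal α) w.1.1))) :=
    isClosed_coe_pi _ fun w => isClosed_chartTorusGLoc L α w.1.1 S'
  haveI : LocallyCompactSpace ↥(Subgroup.pi Set.univ (fun w : {w : {w : {w : InfinitePlace L // IsComplex w} // w ∉ S'} // w.1 ∉ E} => chartTorusGLoc L α w.1.1 S')) :=
    hMcR.isClosedEmbedding_subtypeVal.locallyCompactSpace
  haveI : SecondCountableTopology ↥(Subgroup.pi Set.univ (fun w : {w : {w : {w : InfinitePlace L // IsComplex w} // w ∉ S'} // w.1 ∉ E} => chartTorusGLoc L α w.1.1 S')) :=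
    TopologicalSpace.Subtype.secondCountableTopology _
  haveI : SFinite (quotientMeasure (Subgroup.pi Set.univ (fun w : {w : {w : {w : InfinitePlace L // IsComplex w} // w ∉ S'} // w.1 ∉ E} => chartTorusGLoc L α w.1.1 S')) ρR
            (isClosed_coe_pi _ fun w => isClosed_chartTorusGLoc L α w.1.1 S')
            (Measure.pi fun w : {w : {w : {w : InfinitePlace L // IsComplex w} // w ∉ S'} // w.1 ∉ E} => ν'w w.1.1)) := inferInstance
  -- ★ (A2)+(A3) INSIDE the outer integral, uniformly in the outer variable `z` (the exported kernel above), then the two constants out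
  have h1 := integral_congr_ae (μ := (Measure.pi fun w : {w : {w : {w : InfinitePlace L // IsComplex w} // w ∉ S'} // w.1 ∈ E} =>
      quotientMeasure (chartTorusGLoc L α w.1.1 S') (t w.1.1) (isClosed_chartTorusGLoc L α w.1.1 S') (ν'w w.1.1)))
    (Filter.Eventually.of_forall fun z =>
      prod_splitNormaliser_mul_integral_heldOutFinsetPi_eq L α S' ν'w t E ρR hJ φ hφT hφd κ μN hμC τ hτT hτcoe hτmul hτd ha'c hc z)
  have h2 := ((integral_const_mul _ _).symm.trans h1).trans (integral_const_mul _ _)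
  linear_combination ((∏ w ∈ Finset.univ.filter (fun w => w ∉ S'),
          ((1 - (Circle.exp (c w 1 - c w 0) : ℂ)) * (1 - (Circle.exp (c w 2 - c w 0) : ℂ)) * (1 - (Circle.exp (c w 2 - c w 1) : ℂ)))) *
    (∏ w, ((t w (chartBoxImgGLoc L α w S')).toReal : ℂ))) * h2

end AssemblyFinsetPiIterated
end Literature.NumberTheory.Rogawski1990
end
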